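import Summits.Ventures.Crystal3D.Theorems.StickyWulffConstantGenericWallFloorStackWalkForcedChain
import Summits.Ventures.Crystal3D.Theorems.StickyWulffConstantTextureLiminfTexShadowLayerFluxDefs
import HarnessLib

/-!
# `LayerRowsApart`: the apartness predicate of the LAYER ROWS machine R1 (crux `GenericWallFloor`, stmt-Ventures-19480; lane T's
# `LayerRowsMachine Apart C_R1`, cf-p1 RULINGS (ccxi)/(ccxiii); announced by the R1 owner 19480-p2 g13 2026-08-29T12:38Z)

HONEST FRAMING. Venture `Summits/Ventures/Crystal3D` (cell `crystal3d-full`), route `route-Ventures-StickyWulffConstant`, helper for the crux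
`GenericWallFloor` (stmt-Ventures-19480) / consumer `TextureLiminfV5` (stmt-Ventures-23912).  ONE definition and its unpacking; nothing is
proved about R1 here; F-C1 not moved.

THE POINT.  The in-layer row machine of plate 1 (`barlow_layerRows_inPlane_at`, in preparation) runs THREE kinds of walkers along the best
in-layer bond `w₁ = bestLayerDir L₁ e₃`: the stack walk of lane G with bottom entry `⟨L₁, w₁, 0⟩` on the «++» c-layers, the stack walk with
bottom entry `⟨G₁, w₁, 0⟩` on the «−−» c-layers — `G₁ = twinFrame L₁ (L₁ e₃)`, the basal twin frame, whose cuboctahedron is the dozen of a «−−»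
ball; `G₁ w₁ = L₁ w₁` — and the cap-free h-row walk (`hRowStep`) on the h-layers.  Every stack frame a c-walker can carry lies in the
countable set `chainFrames e₃ L₁ w₁ ∪ chainFrames e₃ G₁ w₁` (`frame_mem_chainFrames_of_stack`), and the h-walkers carry `L₁` (or `neg ≫ L₁`, same
lattice).  The ONE thing the count needs from plate 2's presentation is that no such frame carries the top plate's bilayer lattice `L₂·Λ₀` or
its basal twin's (then no walker ends deep inside the clamped top sample: `frame_of_hFull_deep`, `stackWalk_end_not_high_sep`).  That is
**`LayerRowsApart L₁ L₂`**.  Its failure set is a countable union of the loci `{L₂·Λ₀ = F·Λ₀}`, `{(twinFrame L₂ (L₂ e₃))·Λ₀ = F·Λ₀}` — measure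
zero; lane T's cut files it as the read class `RowReadAt` (19480-p1).
* `LayerRowsApart`, `LayerRowsApartReg` (the `(σ₁ σ₂ L₁ L₂)`-ary form `LayerRowsMachine` takes); unpacking: `LayerRowsApart.of_mem_left/right`,
  `LayerRowsApart.base`, `LayerRowsApart.twinBase`.
WHAT THIS IS NOT: no theorem about R1; F-C1 not moved.
-/

noncomputable section

namespace Summit.Ventures.Crystal3D.Theorems

open Literature.MathematicalPhysics.StatisticalMechanics (fccStacking)
open Summit.Ventures.Crystal3D.Cruxes.TextureLiminf.TexShadow (bestLayerDir)
open scoped InnerProductSpace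

/-- **`LayerRowsApart L₁ L₂`**: no chain frame of plate 1's two row grains — `(L₁, w₁)` and `(twinFrame L₁ (L₁ e₃), w₁)`, `w₁ = bestLayerDir L₁ e₃` —
carries the lattice `L₂·Λ₀` or its basal twin `(twinFrame L₂ (L₂ e₃))·Λ₀`. -/
def LayerRowsApart (L₁ L₂ : EuclideanSpace ℝ (Fin 3) ≃ₗᵢ[ℝ] EuclideanSpace ℝ (Fin 3)) : Prop :=
  ∀ F ∈ chainFrames (EuclideanSpace.single (2 : Fin 3) (1 : ℝ)) L₁ (bestLayerDir L₁ (EuclideanSpace.single (2 : Fin 3) (1 : ℝ))) ∪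
      chainFrames (EuclideanSpace.single (2 : Fin 3) (1 : ℝ)) (twinFrame L₁ (L₁ (EuclideanSpace.single (2 : Fin 3) (1 : ℝ))))
        (bestLayerDir L₁ (EuclideanSpace.single (2 : Fin 3) (1 : ℝ))),
    F '' fccStacking 1 (Real.sqrt (2 / 3)) ≠ L₂ '' fccStacking 1 (Real.sqrt (2 / 3)) ∧
      F '' fccStacking 1 (Real.sqrt (2 / 3)) ≠
        (twinFrame L₂ (L₂ (EuclideanSpace.single (2 : Fin 3) (1 : ℝ)))) '' fccStacking 1 (Real.sqrt (2 / 3))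

/-- The `(σ₁, σ₂, L₁, L₂)`-ary form (the argument shape of lane T's `LayerRowsMachine`); the Hägg words are not read. -/
def LayerRowsApartReg (_σ₁ _σ₂ : ℤ → ℤ) (L₁ L₂ : EuclideanSpace ℝ (Fin 3) ≃ₗᵢ[ℝ] EuclideanSpace ℝ (Fin 3)) : Prop :=
  LayerRowsApart L₁ L₂

/-- Unfolding the regime form. -/
theorem layerRowsApartReg_iff (σ₁ σ₂ : ℤ → ℤ) (L₁ L₂ : EuclideanSpace ℝ (Fin 3) ≃ₗᵢ[ℝ] EuclideanSpace ℝ (Fin 3)) :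
    LayerRowsApartReg σ₁ σ₂ L₁ L₂ ↔ LayerRowsApart L₁ L₂ :=
  Iff.rfl

namespace LayerRowsApart

variable {L₁ L₂ : EuclideanSpace ℝ (Fin 3) ≃ₗᵢ[ℝ] EuclideanSpace ℝ (Fin 3)}

/-- Unpacking on the «++» grain `(L₁, w₁)`. -/
theorem of_mem_left (h : LayerRowsApart L₁ L₂) {F : EuclideanSpace ℝ (Fin 3) ≃ₗᵢ[ℝ] EuclideanSpace ℝ (Fin 3)}
    (hF : F ∈ chainFrames (EuclideanSpace.single (2 : Fin 3) (1 : ℝ)) L₁ (bestLayerDir L₁ (EuclideanSpace.single (2 : Fin 3) (1 : ℝ)))) :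
    F '' fccStacking 1 (Real.sqrt (2 / 3)) ≠ L₂ '' fccStacking 1 (Real.sqrt (2 / 3)) ∧
      F '' fccStacking 1 (Real.sqrt (2 / 3)) ≠
        (twinFrame L₂ (L₂ (EuclideanSpace.single (2 : Fin 3) (1 : ℝ)))) '' fccStacking 1 (Real.sqrt (2 / 3)) :=
  h F (Set.mem_union_left _ hF)

/-- Unpacking on the «−−» grain `(twinFrame L₁ (L₁ e₃), w₁)`. -/
theorem of_mem_right (h : LayerRowsApart L₁ L₂) {F : EuclideanSpace ℝ (Fin 3) ≃ₗᵢ[ℝ] EuclideanSpace ℝ (Fin 3)}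
    (hF : F ∈ chainFrames (EuclideanSpace.single (2 : Fin 3) (1 : ℝ)) (twinFrame L₁ (L₁ (EuclideanSpace.single (2 : Fin 3) (1 : ℝ))))
      (bestLayerDir L₁ (EuclideanSpace.single (2 : Fin 3) (1 : ℝ)))) :
    F '' fccStacking 1 (Real.sqrt (2 / 3)) ≠ L₂ '' fccStacking 1 (Real.sqrt (2 / 3)) ∧
      F '' fccStacking 1 (Real.sqrt (2 / 3)) ≠
        (twinFrame L₂ (L₂ (EuclideanSpace.single (2 : Fin 3) (1 : ℝ)))) '' fccStacking 1 (Real.sqrt (2 / 3)) :=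
  h F (Set.mem_union_right _ hF)

/-- The base frame `L₁` itself is apart (the h-row walkers' hypothesis). -/
theorem base (h : LayerRowsApart L₁ L₂) :
    L₁ '' fccStacking 1 (Real.sqrt (2 / 3)) ≠ L₂ '' fccStacking 1 (Real.sqrt (2 / 3)) ∧
      L₁ '' fccStacking 1 (Real.sqrt (2 / 3)) ≠
        (twinFrame L₂ (L₂ (EuclideanSpace.single (2 : Fin 3) (1 : ℝ)))) '' fccStacking 1 (Real.sqrt (2 / 3)) :=
  h.of_mem_left (self_mem_chainFrames _ _ _)

/-- The basal twin frame `twinFrame L₁ (L₁ e₃)` is apart. -/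
theorem twinBase (h : LayerRowsApart L₁ L₂) :
    (twinFrame L₁ (L₁ (EuclideanSpace.single (2 : Fin 3) (1 : ℝ)))) '' fccStacking 1 (Real.sqrt (2 / 3)) ≠
        L₂ '' fccStacking 1 (Real.sqrt (2 / 3)) ∧
      (twinFrame L₁ (L₁ (EuclideanSpace.single (2 : Fin 3) (1 : ℝ)))) '' fccStacking 1 (Real.sqrt (2 / 3)) ≠
        (twinFrame L₂ (L₂ (EuclideanSpace.single (2 : Fin 3) (1 : ℝ)))) '' fccStacking 1 (Real.sqrt (2 / 3)) :=
  h.of_mem_right (self_mem_chainFrames _ _ _)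

end LayerRowsApart

end Summit.Ventures.Crystal3D.Theorems

end
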